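import Mathlib
import Literature.MathematicalPhysics.QuantumFieldTheory.Balaban1983to89.B12ExpSteps
import Literature.MathematicalPhysics.QuantumFieldTheory.Balaban1983to89.Beta.TransportVertices

/-!
# `Balaban1983to89.B12Plaquette343` — T. Bałaban, *Renormalization group approach to lattice gauge field theories. I.
Generation of effective actions in a small field approximation and a coupling constant renormalization in four
dimensions*, Commun. Math. Phys. **109**, 249–301 (1987) [Balaban1987RG1], **§3 pp. 278–280 [PDF 30–32]: the
"elementary inequality" of (3.43), the triangle inequalities the text leaves implicit, and "(3.43) slightly modified
for the present situation" (3.52) — AS THEOREMS for the plaquette variable of the configuration exp iξ𝐇 in a complete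
normed ℂ-algebra** — a NEW satellite leaf of `…Balaban1983to89.B12ExpSteps` (whose `ineq343` / `ineq344_of_inputs` /
`condIII_first_of_inputs` take the elementary inequality `helem`, the (3.37) sums `hP0`/`hP` and the triangle inequalities
`htri`, `htri₁`–`htri₄` as HYPOTHESES on schematic reals) and of the TREE module `…Balaban1983to89.Beta.TransportVertices`
(unit `b2b-balaban-beta-w2-g9`: ordered products of exponentials `holonomy l = exp b₁ ⋯ exp b_n` in a complete normed
algebra, `size l = Σ‖b_i‖`, and the first-order remainder bound `norm_holonomy_sub_taylor_one_le` ‖holonomy l − 1 − Σ b_i‖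
≤ e^{size l} − 1 − size l, with `expTail_two_le` eˢ − 1 − s ≤ ½s²eˢ) — it imports these two modules only (hence
`…B12CondIIIJ`, `…B12Sec2to5`) and modifies nothing.  Every analytic fact used is a TREE THEOREM invoked BY NAME; nothing is
re-proved.

CITATION HEADER (lean-in-tree rule 2026-08-18; PDF held `paper:balaban1987-cmp109-rg-i-small-field`, PDF page = journal
page − 248; renders `b2b-balaban-ref1/pages/1987-cmp109-rg-I-small-field/1987-cmp109-rg-I-small-field-pNNN-x2.png`,
NNN = 014, 030, 031, 032, re-read as images by the typing unit `b2b-balaban-b12-g15`; p030 re-read as image by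
`b2b-balaban-b12-g16` for v1.1).  THE PRINTED LOCI, verbatim:
* p. 262 [14] (1.14): *"(iii) The configurations 𝐔, 𝐉 satisfy the bounds |∂𝐔 − 1| < α₀ξ², |𝐉| < γ₀ on X. (1.14)"*
  (𝐔 with values in Gᶜ, p. 262 l. 3).
* p. 278 [30] (3.43): *"From the bounds in (3.37), and an elementary inequality, we get |∂ exp iξ𝐇_j(...) − 1 −
  iξ²(∂^ξ𝐇_j(...)|"* [sic: the parenthesis opened before ∂^ξ is not closed in print] *"≦ ½(∂|𝐇_j(...)|)²ξ² exp ∂ξ|𝐇_j(...)| <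
  8(B₃²O(1)Mα₀L^{j−1}η)²ξ² exp 4B₃²O(1)Mα₀L⁻¹η < (4B₃²O(1)M)²α₀²(L^{j−1}η)²ξ² on □̃³. (3.43)"* — the print's literal
  «𝐇_j(...)» (four times) abbreviates 𝐇_j(□₀, Q(L⁻¹η𝐇_{k+1})), the argument displayed in (3.41) just above it and in (3.44)
  just below it [gloss, not part of the quotation; v1.1, XREAD C-pv27-62 m1]; (3.37), (3.41), (3.44)–(3.47) as quoted in the
  headers of `B12ExpSteps` / `B12CondIIIJ` (pp. 277–279).
* p. 279 [31]: *"Furthermore, the function 𝐇_j is given by (174) [15], i.e. 𝐇_j(□₀, B) = H_{1,j}B + 𝐀_{1,j}(B) −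
  H_jD_j(H_{1,j}B + 𝐀_{1,j}(B)), where the functions on the righ-hand side"* [sic] *"are at least of second order, except
  the first term. This implies |∂^ξ𝐇_j(□₀, Q(L⁻¹η𝐇_{k+1})) − ∂^ξH_{1,j}Q(L⁻¹η𝐇_{k+1})| < B₃(B₃O(1)Mα₀L^{j−1}η)² < βα₀(L^{j−1}η)²
  on □̃³. (3.45)"*; *"This inequality is linear in Q(…), hence it is valid also for this expression replaced by τQ(…),
  τ ∈ [0, 1]. From the above considerations it is obvious that we can reverse the arguments, thus we obtain (3.44) with
  τQ(…), and the factor 1+6β on the right-hand side."*; (3.50): *"𝐇_j(□₀, τQ(L⁻¹η𝐇_{k+1}) + B′) = 𝐇_j(□₀, τQ(L⁻¹η𝐇_{k+1}))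
  + ∫₀¹dt₂⟨(δ/δB 𝐇_j)(□₀, τQ(L⁻¹η𝐇_{k+1}) + t₂B′), B′⟩ = 𝐇_j(□₀, τQ(L⁻¹η𝐇_{k+1})) + 𝐀₂, (3.50)"*.
* p. 280 [32]: *"where the last equality is a definition of 𝐀₂. It implies |𝐀₂|, |∇^ξ𝐀₂| ≦ B₃|B′| < B₃α₃,"*; *"Consider
  now the derivative |∂^ξ𝐇_j(□₀, τQ(L⁻¹η𝐇_{k+1}) + B′)| ≦ |∂^ξ𝐇_j(□₀, τQ(L⁻¹η𝐇_{k+1}))| + |∂^ξ𝐀₂| < (1+6β)α₀(L^{j−1}η)² +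
  2B₃α₃ ≦ (1+6β))L⁻²α₀"* [sic: stray «)», cf. `B12CondIIIJ` v1.1] *"+ 2B₃α₃ ≦ (1+7β)L⁻²α₀ on □̃³, (3.51) where we have
  assumed 2B₃α₃ ≦ βL⁻²α₀. The above inequality, and the inequality (3.43) slightly modified for the present situation, give
  the bound |∂ exp iξ𝐇_j(□₀, τQ(L⁻¹η𝐇_{k+1}) + B′) − 1| < (1+8β)L⁻²α₀ξ² on □̃³. (3.52) This implies the first inequality
  in the condition (iii)."*
* Orientation conventions of the series, as recorded in the cell glossary NOTATION.md §4 (v2.22): B7 = [Balaban1985Averaging]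
  p. 18 (6)–(7) «U(x′, x) = U⁻¹(x, x′)», (9) «for Γ = ∪_i ⟨x_i, x_{i+1}⟩, U(Γ) = Π_i U(x_i, x_{i+1}) in the order of the
  bonds; U(∂p) = (∂U)(p)» (glossary wording, B7 held as scan); B9 = [Balaban1985BackgroundPropagators] (CMP 99:389) p. 391 (3.5), verbatim there
  from its render p003: *"U(x, x′) = U⁻¹(x′, x), A(x, x′) = −A(x′, x) for a bond ⟨x, x′⟩"*, *"We always make this
  assumption about gauge field configurations"*.

VERSION: v1 p185013 (unit `b2b-balaban-b12-g15`) → v1.1 (unit `b2b-balaban-b12-g16`) = DOCSTRINGS ONLY, after the two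
cross-reads `HOME/b2b-balaban-pv27-g10/XREAD-B12Plaquette343-v1.md` (GAPS C-pv27-62, verdict ok-with-DOCFIX: m1 the p. 278
(3.43) quotation above now carries the print's literal «𝐇_j(...)», its expansion moved into a bracketed gloss, and the
print's unclosed parenthesis is marked [sic]; R-pv27-71 attribution gloss on the (3.45)-instance at τQ(…)) and
`HOME/b2b-balaban-adv2/g45/XREAD2-B12Plaquette343-v1.md` (GAPS C-adv2-67, second, adversarial read, verdict ok-with-DOCFIX:
R1 the SCOPE clause on the two matrix norms of the series in the next paragraph; R2 the remark on `hξ1` in §5).  Every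
`theorem` statement and proof is byte-identical to v1.

THE PLAQUETTE READING (the only modelling step; DIVERGENCE D-b12g15.1).  For a plaquette p = ⟨x, x+ξe_μ, x+ξe_μ+ξe_ν,
x+ξe_ν⟩ let H₁, H₂, H₃, H₄ ∈ 𝔸 be the values of the 𝔤ᶜ-valued field 𝐇 on the four POSITIVELY oriented bonds ⟨x, x+ξe_μ⟩,
⟨x+ξe_μ, x+ξe_μ+ξe_ν⟩, ⟨x+ξe_ν, x+ξe_ν+ξe_μ⟩, ⟨x, x+ξe_ν⟩.  The configuration exp iξ𝐇 has bond variables U(b) = exp iξ𝐇(b),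
and by the conventions above U(b̄) = U(b)⁻¹ = exp(−iξ𝐇(b)) on the reversed bonds, so its plaquette variable is the
ORDERED PRODUCT (∂ exp iξ𝐇)(p) = e^{iξH₁}e^{iξH₂}e^{−iξH₃}e^{−iξH₄} = `holonomy [(I*ξ)•H₁, (I*ξ)•H₂, −((I*ξ)•H₃), −((I*ξ)•H₄)]`;
the ξ-lattice exterior derivative is (∂^ξ𝐇)(p) = ξ⁻¹(H₁ + H₂ − H₃ − H₄) = `(ξ:ℂ)⁻¹ • (H₁ + H₂ − H₃ − H₄)`, so that
iξ²(∂^ξ𝐇)(p) = iξ(H₁ + H₂ − H₃ − H₄) is the sum of the four exponents (`sum_plaquette`, `linear_term_eq`); and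
(∂|𝐇|)(p) := ‖H₁‖ + ‖H₂‖ + ‖H₃‖ + ‖H₄‖ (the reading of the print's *"½(∂|𝐇_j|)²ξ² exp ∂ξ|𝐇_j|"* forced by its next step
*"< 8(B₃²O(1)Mα₀L^{j−1}η)²ξ² exp 4B₃²O(1)Mα₀L⁻¹η"* from the bond bounds (3.37): ½·(4h)² = 8h², exp ξ·4h with ξL^{j−1}η =
L⁻¹η).  𝔸 is ANY complete normed ℂ-algebra (`[NormedRing 𝔸] [NormedAlgebra ℂ 𝔸] [CompleteSpace 𝔸]`; no commutativity, no
‖1‖ = 1): it specialises to M_N(ℂ) ⊃ Gᶜ, 𝔤ᶜ with any submultiplicative algebra norm, which is how the print's |·| on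
Gᶜ-valued plaquette variables (p. 262 (iii)) and 𝔤ᶜ-valued fields is read.  SCOPE OF THAT READING (v1.1, XREAD C-adv2-67
R1): the series uses TWO matrix norms — the operator norm |·| of B7 (19) (submultiplicative: a `NormedRing` norm on M_N(ℂ),
under which every theorem below applies verbatim) and the NORMALISED Hilbert–Schmidt norm ‖X‖² = tr X*X with the normalised
trace tr = (1/N)Σ of B7 (17) (B12 p. 252: *"tr is the normalized trace, i.e. tr 1 = 1"*; B9 p. 390 declares its |·| to be
this Hilbert–Schmidt norm, DIVERGENCE D-r1.1), which is NOT submultiplicative (GAPS G-f1-1, kernel witness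
`MatrixNorms.nhsNorm_mul_not_submultiplicative` in the tree module `…Balaban1983to89.MatrixNorms`) and therefore is NOT an
instance of `[NormedRing 𝔸]`.  B12 pp. 252–254, 262, 277–280 do not re-declare which of the two norms (1.14)(iii) and (3.37)
carry (renders p004/p005/p014/p029–p032; C-adv2-67).  Under the normalised Hilbert–Schmidt reading the theorems transfer only
through the conversion ‖X‖_{HS,norm} ≤ |X| ≤ √N·‖X‖_{HS,norm} (D-r1.1): apply them in the operator norm with the (3.37) bond
bounds h replaced by √N·h (a factor N inside the print's «8(…)²» and √N in the exponent of (3.43), to be absorbed by the O(1)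
of conj. 10 — *"constants silently depend on N"*, D-r1.1) and read the operator-norm conclusions as upper bounds for the
Hilbert–Schmidt ones.  Nothing below depends on which reading is meant; the clause only delimits what "verbatim" covers.
The gauge factor R((vū_{k+1}v_ju_j)⁻¹) of (3.41) and the functions 𝐇_j, H_{1,j}, 𝐀₂ of [Balaban1985Variational] are NOT
modelled: the first inequality of (3.41), the bond bounds (3.37), the second-order bounds (3.45) (at Q(…), and at τQ(…)
against τ times the linear part — the (3.45)-type instance that p. 279 *"we can reverse the arguments"* uses implicitly;
the sentence *"This inequality is linear in Q(…)"* there refers to (3.46), the bound on the linear part ∂^ξH_{1,j}Q; v1.1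
attribution gloss, XREAD R-pv27-71) and (3.50) *"|𝐀₂|, |∇^ξ𝐀₂| ≦ B₃|B′|"* enter as HYPOTHESES on the bond data, exactly as
in `B12ExpSteps`, but now on elements of 𝔸 rather than on schematic reals.

WHAT IS CHECKED HERE, and nothing else.
(§1) The "elementary inequality" for ANY contour in 𝔸: Σ‖b_i‖ ≤ s ⇒ ‖e^{b₁}⋯e^{b_n} − 1 − Σb_i‖ ≤ ½s²eˢ and ‖e^{b₁}⋯e^{b_n} −
1‖ ≤ eˢ − 1 (the tree's `norm_holonomy_sub_taylor_one_le` / `norm_holonomy_sub_one_le` + `expTail_mono` + `expTail_two_le`,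
by name).  (§2) For the plaquette: `size` = ξ·∂|𝐇|, `sum` = iξ²∂^ξ𝐇, hence **the first «≦» of (3.43) is a THEOREM**
(`elem343`; `helem343` = exactly the hypothesis `helem` of `B12ExpSteps`, ξ² divided out).  (§3) With the four (3.37) bond
bounds (`sum337` = the hypotheses `hP0`, `hP`): the whole display (3.43) for the plaquette (`ineq343_mid_plaquette`,
`ineq343_plaquette`, via `B12ExpSteps.ineq343_mid/ineq343`); the triangle inequalities behind (3.44), (3.46)/its τ-version
and (3.47) as norm facts in 𝔸 (`tri344`, `tri346`, `tri347` = the hypotheses `htri`, `htri₁`–`htri₄`); (3.44) for the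
plaquette from the LITERAL first inequality of (3.41) (with its printed (L⁻¹η)², converted by ξ·L^{j−1}η = L⁻¹η) and the
bond bounds (`ineq344_plaquette`).  (§4) **The first inequality of (iii), ‖∂ exp iξ𝐇_j(□₀, τQ(…)) − 1‖ < α₀ξ², B′ = 0, every
τ ∈ [0, 1]** (`condIII_first_plaquette`): `B12ExpSteps.condIII_first_of_inputs` with `helem`, `hP0`, `hP`, `htri₁`–`htri₄`,
`hD₁`, `helemτ`, `hPτ0`, `hPτ` ALL DISCHARGED — the remaining hypotheses are the paper-specific inputs listed above plus
`B12Sec2to5.Lemma4Restrictions c` and the three unlisted constant hypotheses of `B12ExpSteps` (B₃ ≥ 1, B₃²O₁M ≥ 1,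
16·O₁Mα₁ ≤ β; see that module's §2–§3 for why the printed *"e.g. O(1)Mα₁ ≦ β"* does not suffice).  (§5) **B′ ≠ 0, (3.50)–
(3.52) with the PRINTED count 1+8β** (`condIII_first_plaquette_shifted`): for the shifted bond data K_i + A_i, (3.51)'s
first «≦» is linearity + triangle (`deriv_shift_le`), its *"2B₃α₃"* is |∂^ξ𝐀₂| ≤ |∇^ξ_μ(𝐀₂)_ν| + |∇^ξ_ν(𝐀₂)_μ| (`deriv_A_le`),
its constants are `B12Sec2to5.ineq351`; *"(3.43) slightly modified for the present situation"* is the THEOREM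
`elem343_shift` (remainder ≤ 8(h+a)²ξ²e^{4ξ(h+a)}, h = B₃²O(1)Mα₀L^{j−1}η, a = B₃α₃); and the single β by which (3.51)'s
1+7β becomes (3.52)'s 1+8β — the budget 8(h+a)²e^{4ξ(h+a)} < βL⁻²α₀ — CLOSES from the typed restrictions conj. 10, 13, 14,
β ≤ β₀ < 1 and B₃²O₁M ≥ 1 with NO new smallness (`budget352`: u := 4B₃²O(1)Mα₀L⁻¹ has u² ≤ βL⁻²α₀ ≤ 1/128, so u ≤ 1/11,
h ≤ u/4, a ≤ ½βL⁻²α₀, e^{4ξ(h+a)} ≤ 1 + 2(u + 2βL⁻²α₀); product ≤ 0.85·βL⁻²α₀), then `B12Sec2to5.ineq352_closes`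
((1+8β)L⁻² ≤ 1 ⇐ conj. 14) gives ‖∂ exp iξ(𝐇_j(□₀, τQ(…)) + 𝐀₂) − 1‖ < α₀ξ².  Located finding (harmless, positive): at
this step the print's *"for α₀, …, α₃ sufficiently small and satisfying all the restrictions"* (Lemma 4) needs nothing
beyond the typed list and B₃²O(1)M ≥ 1 — as for the exponential factor of (3.43) (`B12ExpSteps.exp343_lt_two`).
SCHEMATIC PARAMETERS (as in `B12CondIIIJ` / `B12ExpSteps`, DIVERGENCE D-b03.1 / D-b12g13.1 / D-b12g14.1): x := L^{j−1}η with
1 ≤ j, L^jη ≤ 1; ξ > 0 with the hypothesis `hξx` : ξ·x = L⁻¹η (ξ = L^{−j}) and, in §5, ξ ≤ 1; τ ∈ [0, 1]; n = |B′| < α₃.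
ABSOLUTE RULE.  Nothing of the series is asserted: the displayed bounds on the paper's specific functions enter ONLY as
hypotheses; what is PROVED is Banach-algebra calculus + real arithmetic; no `def`, no `def … : Prop`, no sorry.  `[cite: …]`
tags mark a PRINTED display (or sentence) whose content the theorem proves under the plaquette reading or whose arithmetic
it checks; `[folklore]` tags mark elementary normed-algebra / real-arithmetic facts — each docstring says which.  NOT summit
progress: first-order Taylor remainders of one plaquette variable inside the small-field analytic-extension lemma (Lemma 4)
of one paper of the programme; nothing about Theorem 2's flow, the infinite volume or the Clay problem.
-/

namespace Literature.MathematicalPhysics.QuantumFieldTheory.Balaban1983to89.B12Plaquette343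

open Literature.MathematicalPhysics.QuantumFieldTheory.Balaban1983to89
open Literature.MathematicalPhysics.QuantumFieldTheory.Balaban1983to89.Beta.TransportVertices
open Complex (I)

variable {𝔸 : Type*} [NormedRing 𝔸] [NormedAlgebra ℂ 𝔸] [CompleteSpace 𝔸]

/-! ## §1  The elementary inequality for an arbitrary contour -/

/-- **The "elementary inequality", any contour.**  In a complete normed ℂ-algebra, for bond variables b₁, …, b_n with
Σ‖b_i‖ ≤ s:  ‖exp b₁ ⋯ exp b_n − 1 − Σ b_i‖ ≤ ½ s² eˢ — the TREE's first-order transport-vertex bound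
`Beta.TransportVertices.norm_holonomy_sub_taylor_one_le` (remainder ≤ eˢ⁽ˡ⁾ − 1 − s(l), s(l) = Σ‖b_i‖) followed by
`expTail_mono` / `expTail_two_le` (eˢ − 1 − s ≤ ½ s² eˢ for s ≥ 0).  No hypothesis on ‖1‖, no commutativity. [folklore] -/
theorem norm_holonomy_sub_one_sub_sum_le (l : List 𝔸) {s : ℝ} (hs : size l ≤ s) :
    ‖holonomy l - 1 - l.sum‖ ≤ 1 / 2 * s ^ 2 * Real.exp s := by
  have h0 : 0 ≤ size l := size_nonneg l
  have h1 : ‖holonomy l - 1 - l.sum‖ ≤ expTail 2 (size l) := norm_holonomy_sub_taylor_one_le ℂ l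
  have h2 : expTail 2 (size l) ≤ expTail 2 s := expTail_mono 2 h0 hs
  have h3 : expTail 2 s ≤ s ^ 2 / 2 * Real.exp s := expTail_two_le (h0.trans hs)
  calc ‖holonomy l - 1 - l.sum‖ ≤ expTail 2 (size l) := h1
    _ ≤ s ^ 2 / 2 * Real.exp s := h2.trans h3
    _ = 1 / 2 * s ^ 2 * Real.exp s := by ring

/-- Zeroth order, any contour: Σ‖b_i‖ ≤ s ⇒ ‖exp b₁ ⋯ exp b_n − 1‖ ≤ eˢ − 1 (`norm_holonomy_sub_one_le` + monotonicity).
[folklore] -/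
theorem norm_holonomy_sub_one_le_of_size_le (l : List 𝔸) {s : ℝ} (hs : size l ≤ s) :
    ‖holonomy l - 1‖ ≤ Real.exp s - 1 := by
  have h0 : 0 ≤ size l := size_nonneg l
  have h1 : ‖holonomy l - 1‖ ≤ expTail 1 (size l) := norm_holonomy_sub_one_le ℂ l
  have h2 : expTail 1 (size l) ≤ expTail 1 s := expTail_mono 1 h0 hs
  simp only [expTail_one] at h1 h2
  exact h1.trans h2

/-! ## §2  The plaquette variable of the configuration exp iξ𝐇 (four oriented bonds) -/

omit [CompleteSpace 𝔸] in
/-- The size of the plaquette's bond list: for ξ ≥ 0, Σ_{b ∈ ∂p} ‖±iξ𝐇(b)‖ = ξ·(‖H₁‖ + ‖H₂‖ + ‖H₃‖ + ‖H₄‖) = ξ·(∂|𝐇|)(p)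
— the exponent *"∂ξ|𝐇_j(…)|"* of (3.43). [folklore] -/
theorem size_plaquette {ξ : ℝ} (hξ : 0 ≤ ξ) (H₁ H₂ H₃ H₄ : 𝔸) :
    size [(I * ξ) • H₁, (I * ξ) • H₂, -((I * ξ) • H₃), -((I * ξ) • H₄)] =
      ξ * (‖H₁‖ + ‖H₂‖ + ‖H₃‖ + ‖H₄‖) := by
  have hI : ‖(I * ξ : ℂ)‖ = ξ := by
    rw [norm_mul, Complex.norm_I, one_mul, Complex.norm_of_nonneg hξ]
  simp only [size_cons, size_nil, norm_neg, norm_smul, hI]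
  ring

omit [CompleteSpace 𝔸] in
/-- The linear term of the plaquette: Σ_{b ∈ ∂p} (±iξ𝐇(b)) = iξ(H₁ + H₂ − H₃ − H₄) = iξ²(∂^ξ𝐇)(p), with
(∂^ξ𝐇)(p) = ξ⁻¹(H₁ + H₂ − H₃ − H₄) the ξ-lattice exterior derivative. [folklore] -/
theorem sum_plaquette (ξ : ℝ) (H₁ H₂ H₃ H₄ : 𝔸) :
    ([(I * ξ) • H₁, (I * ξ) • H₂, -((I * ξ) • H₃), -((I * ξ) • H₄)] : List 𝔸).sum =
      (I * ξ) • (H₁ + H₂ - H₃ - H₄) := by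
  simp only [List.sum_cons, List.sum_nil, smul_add, smul_sub, add_zero]
  abel

omit [CompleteSpace 𝔸] in
/-- iξ²·(∂^ξ𝐇)(p) = iξ(H₁ + H₂ − H₃ − H₄): the two spellings of the linear term agree (ξ ≠ 0). [folklore] -/
theorem linear_term_eq {ξ : ℝ} (hξ : ξ ≠ 0) (H₁ H₂ H₃ H₄ : 𝔸) :
    (I * ξ ^ 2) • ((ξ : ℂ)⁻¹ • (H₁ + H₂ - H₃ - H₄)) = (I * ξ) • (H₁ + H₂ - H₃ - H₄) := by
  rw [smul_smul]
  congr 1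
  have hξ' : (ξ : ℂ) ≠ 0 := Complex.ofReal_ne_zero.mpr hξ
  field_simp

/-- **B12 (3.43), first «≦» — the print's "elementary inequality", PROVED** (p. 278 [30]: *"From the bounds in (3.37),
and an elementary inequality, we get |∂ exp iξ𝐇_j(…) − 1 − iξ²(∂^ξ𝐇_j(…))| ≦ ½(∂|𝐇_j(…)|)²ξ² exp ∂ξ|𝐇_j(…)|"*): under
the plaquette reading (∂U)(p) = U(b₁)U(b₂)U(b₃)⁻¹U(b₄)⁻¹ with U(b) = exp iξ𝐇(b), U(b̄) = U(b)⁻¹ = exp(−iξ𝐇(b)), for every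
ξ ≥ 0 and all H₁, …, H₄ in a complete normed ℂ-algebra:
‖e^{iξH₁}e^{iξH₂}e^{−iξH₃}e^{−iξH₄} − 1 − iξ(H₁ + H₂ − H₃ − H₄)‖ ≤ ½(Σ‖H_i‖)²ξ² exp(ξΣ‖H_i‖).  A THEOREM here (§1 with
s = ξ·Σ‖H_i‖), no longer an analytic input. [cite: Balaban1987RG1, (3.43) p.278 — first inequality, PROVED under the
plaquette reading of NOTATION §4] -/
theorem elem343 {ξ : ℝ} (hξ : 0 ≤ ξ) (H₁ H₂ H₃ H₄ : 𝔸) :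
    ‖holonomy [(I * ξ) • H₁, (I * ξ) • H₂, -((I * ξ) • H₃), -((I * ξ) • H₄)] - 1
        - (I * ξ) • (H₁ + H₂ - H₃ - H₄)‖ ≤
      1 / 2 * (‖H₁‖ + ‖H₂‖ + ‖H₃‖ + ‖H₄‖) ^ 2 * ξ ^ 2 *
        Real.exp (ξ * (‖H₁‖ + ‖H₂‖ + ‖H₃‖ + ‖H₄‖)) := by
  have h := norm_holonomy_sub_one_sub_sum_le
    [(I * ξ) • H₁, (I * ξ) • H₂, -((I * ξ) • H₃), -((I * ξ) • H₄)] (size_plaquette hξ H₁ H₂ H₃ H₄).le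
  rw [sum_plaquette] at h
  calc _ ≤ _ := h
    _ = _ := by ring

/-- The same with ξ² divided out — EXACTLY the hypothesis `helem : T₄₃ ≤ ½P²·exp(ξP)` of `B12ExpSteps.ineq343` /
`ineq344_of_inputs` / `condIII_first_of_inputs` (T₄₃ = ξ⁻²‖∂ exp iξ𝐇 − 1 − iξ²∂^ξ𝐇‖, P = ∂|𝐇| = Σ‖H_i‖), now DISCHARGED
for ξ > 0. [cite: Balaban1987RG1, (3.43) p.278 — first inequality, ξ² cancelled] -/
theorem helem343 {ξ : ℝ} (hξ : 0 < ξ) (H₁ H₂ H₃ H₄ : 𝔸) :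
    ‖holonomy [(I * ξ) • H₁, (I * ξ) • H₂, -((I * ξ) • H₃), -((I * ξ) • H₄)] - 1
        - (I * ξ) • (H₁ + H₂ - H₃ - H₄)‖ / ξ ^ 2 ≤
      1 / 2 * (‖H₁‖ + ‖H₂‖ + ‖H₃‖ + ‖H₄‖) ^ 2 * Real.exp (ξ * (‖H₁‖ + ‖H₂‖ + ‖H₃‖ + ‖H₄‖)) := by
  have hξ2 : 0 < ξ ^ 2 := by positivity
  rw [div_le_iff₀ hξ2]
  calc _ ≤ _ := elem343 hξ.le H₁ H₂ H₃ H₄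
    _ = _ := by ring

/-- Zeroth order for the plaquette: ‖∂ exp iξ𝐇 − 1‖ ≤ exp(ξ·∂|𝐇|) − 1. [folklore] -/
theorem plaquette_sub_one_le {ξ : ℝ} (hξ : 0 ≤ ξ) (H₁ H₂ H₃ H₄ : 𝔸) :
    ‖holonomy [(I * ξ) • H₁, (I * ξ) • H₂, -((I * ξ) • H₃), -((I * ξ) • H₄)] - 1‖ ≤
      Real.exp (ξ * (‖H₁‖ + ‖H₂‖ + ‖H₃‖ + ‖H₄‖)) - 1 :=
  norm_holonomy_sub_one_le_of_size_le _ (size_plaquette hξ H₁ H₂ H₃ H₄).le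

/-! ## §3  The whole display (3.43) and the display (3.44) for the plaquette, from the (3.37) bond bounds -/

omit [NormedAlgebra ℂ 𝔸] [CompleteSpace 𝔸] in
/-- **(3.37) summed over ∂p**: four strict bond bounds ‖H_i‖ < h give 0 ≤ ∂|𝐇| < 4h — the hypotheses `hP0`, `hP` of
`B12ExpSteps.ineq343`. [cite: Balaban1987RG1, (3.37) p.277 — summed over the four bonds of a plaquette] -/
theorem sum337 {h : ℝ} {H₁ H₂ H₃ H₄ : 𝔸} (h₁ : ‖H₁‖ < h) (h₂ : ‖H₂‖ < h) (h₃ : ‖H₃‖ < h) (h₄ : ‖H₄‖ < h) :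
    0 ≤ ‖H₁‖ + ‖H₂‖ + ‖H₃‖ + ‖H₄‖ ∧ ‖H₁‖ + ‖H₂‖ + ‖H₃‖ + ‖H₄‖ < 4 * h :=
  ⟨by positivity, by linarith⟩

/-- **(3.43), first + middle inequality, for the plaquette**: ‖∂ exp iξ𝐇 − 1 − iξ²∂^ξ𝐇‖ < 8(B₃²O(1)Mα₀x)²ξ²·exp 4B₃²O(1)Mα₀L⁻¹η
from the four (3.37) bond bounds ‖H_i‖ < B₃²O(1)Mα₀x (x = L^{j−1}η, ξx = L⁻¹η) — `elem343` + `B12ExpSteps.ineq343_mid`.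
[cite: Balaban1987RG1, (3.43) p.278 — first two inequalities] -/
theorem ineq343_mid_plaquette {B₃ O₁ M α₀ L η ξ x : ℝ} (hξ : 0 < ξ) (hξx : ξ * x = L⁻¹ * η)
    {H₁ H₂ H₃ H₄ : 𝔸} (h₁ : ‖H₁‖ < B₃ ^ 2 * O₁ * M * α₀ * x) (h₂ : ‖H₂‖ < B₃ ^ 2 * O₁ * M * α₀ * x)
    (h₃ : ‖H₃‖ < B₃ ^ 2 * O₁ * M * α₀ * x) (h₄ : ‖H₄‖ < B₃ ^ 2 * O₁ * M * α₀ * x) :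
    ‖holonomy [(I * ξ) • H₁, (I * ξ) • H₂, -((I * ξ) • H₃), -((I * ξ) • H₄)] - 1
        - (I * ξ) • (H₁ + H₂ - H₃ - H₄)‖ <
      8 * (B₃ ^ 2 * O₁ * M * α₀ * x) ^ 2 * ξ ^ 2 * Real.exp (4 * B₃ ^ 2 * O₁ * M * α₀ * (L⁻¹ * η)) := by
  have hS := sum337 h₁ h₂ h₃ h₄
  have h := B12ExpSteps.ineq343_mid hξ.le hξx (helem343 hξ H₁ H₂ H₃ H₄) hS.1 hS.2
  rw [div_lt_iff₀ (by positivity)] at h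
  calc _ < _ := h
    _ = _ := by ring

/-- **(3.43), the whole display, for the plaquette**: ‖∂ exp iξ𝐇 − 1 − iξ²∂^ξ𝐇‖ < (4B₃²O(1)M)²α₀²(L^{j−1}η)²ξ² from the
four (3.37) bond bounds and exp 4B₃²O(1)Mα₀L⁻¹η < 2 (`B12ExpSteps.exp343_lt_two[_of_restrictions]`) — `elem343` +
`B12ExpSteps.ineq343`; the only remaining inputs are the (3.37) bounds. [cite: Balaban1987RG1, (3.43) p.278] -/
theorem ineq343_plaquette {B₃ O₁ M α₀ L η ξ x : ℝ} (hξ : 0 < ξ) (hξx : ξ * x = L⁻¹ * η)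
    {H₁ H₂ H₃ H₄ : 𝔸} (h₁ : ‖H₁‖ < B₃ ^ 2 * O₁ * M * α₀ * x) (h₂ : ‖H₂‖ < B₃ ^ 2 * O₁ * M * α₀ * x)
    (h₃ : ‖H₃‖ < B₃ ^ 2 * O₁ * M * α₀ * x) (h₄ : ‖H₄‖ < B₃ ^ 2 * O₁ * M * α₀ * x)
    (hexp : Real.exp (4 * B₃ ^ 2 * O₁ * M * α₀ * (L⁻¹ * η)) < 2) :
    ‖holonomy [(I * ξ) • H₁, (I * ξ) • H₂, -((I * ξ) • H₃), -((I * ξ) • H₄)] - 1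
        - (I * ξ) • (H₁ + H₂ - H₃ - H₄)‖ < (4 * B₃ ^ 2 * O₁ * M) ^ 2 * α₀ ^ 2 * x ^ 2 * ξ ^ 2 := by
  have hS := sum337 h₁ h₂ h₃ h₄
  have h := B12ExpSteps.ineq343 hξ.le hξx (helem343 hξ H₁ H₂ H₃ H₄) hS.1 hS.2 hexp
  rwa [div_lt_iff₀ (by positivity)] at h

omit [CompleteSpace 𝔸] in
/-- The norm of the exterior derivative in the two spellings: ‖(∂^ξ𝐇)(p)‖ = ‖ξ⁻¹(H₁ + H₂ − H₃ − H₄)‖ =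
ξ⁻²‖iξ(H₁ + H₂ − H₃ − H₄)‖ (ξ > 0) — the schematic `D = ξ⁻²·‖iξ²∂^ξ𝐇‖` of `B12CondIIIJ`/`B12ExpSteps`. [folklore] -/
theorem norm_deriv_eq {ξ : ℝ} (hξ : 0 < ξ) (S : 𝔸) :
    ‖(ξ : ℂ)⁻¹ • S‖ = ‖(I * ξ) • S‖ / ξ ^ 2 := by
  have hI : ‖(I * ξ : ℂ)‖ = ξ := by
    rw [norm_mul, Complex.norm_I, one_mul, Complex.norm_of_nonneg hξ.le]
  have hIinv : ‖((ξ : ℂ)⁻¹)‖ = ξ⁻¹ := by rw [norm_inv, Complex.norm_of_nonneg hξ.le]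
  rw [norm_smul, norm_smul, hI, hIinv]
  field_simp

omit [CompleteSpace 𝔸] in
/-- **The triangle inequality behind (3.44)** (p. 279: *"The above inequality and (3.41) yield |∂^ξ𝐇_j(…)| < …"*):
‖∂^ξ𝐇‖ ≤ ξ⁻²(‖∂ exp iξ𝐇 − 1‖ + ‖∂ exp iξ𝐇 − 1 − iξ²∂^ξ𝐇‖), for ANY W (here the plaquette variable) — the hypothesis
`htri`/`htri₁` of `B12ExpSteps.ineq344_of_inputs` / `condIII_first_of_inputs`, DISCHARGED. [folklore] -/
theorem tri344 {ξ : ℝ} (hξ : 0 < ξ) (W : 𝔸) (H₁ H₂ H₃ H₄ : 𝔸) :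
    ‖(ξ : ℂ)⁻¹ • (H₁ + H₂ - H₃ - H₄)‖ ≤
      ‖W - 1‖ / ξ ^ 2 + ‖W - 1 - (I * ξ) • (H₁ + H₂ - H₃ - H₄)‖ / ξ ^ 2 := by
  rw [norm_deriv_eq hξ, ← add_div]
  have hξ2 : 0 < ξ ^ 2 := by positivity
  gcongr
  calc ‖(I * ξ) • (H₁ + H₂ - H₃ - H₄)‖
        = ‖(W - 1) - (W - 1 - (I * ξ) • (H₁ + H₂ - H₃ - H₄))‖ := by rw [sub_sub_cancel]
    _ ≤ _ := norm_sub_le _ _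

omit [CompleteSpace 𝔸] in
/-- **The triangle inequality behind (3.47)/(3.52)**: ξ⁻²‖W − 1‖ ≤ ‖∂^ξ𝐊‖ + ξ⁻²‖W − 1 − iξ²∂^ξ𝐊‖ — the hypothesis `htri₄` of
`B12ExpSteps.condIII_first_of_inputs`, DISCHARGED. [folklore] -/
theorem tri347 {ξ : ℝ} (hξ : 0 < ξ) (W : 𝔸) (K₁ K₂ K₃ K₄ : 𝔸) :
    ‖W - 1‖ / ξ ^ 2 ≤
      ‖(ξ : ℂ)⁻¹ • (K₁ + K₂ - K₃ - K₄)‖ + ‖W - 1 - (I * ξ) • (K₁ + K₂ - K₃ - K₄)‖ / ξ ^ 2 := by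
  rw [norm_deriv_eq hξ, ← add_div]
  have hξ2 : 0 < ξ ^ 2 := by positivity
  gcongr
  calc ‖W - 1‖ = ‖(I * ξ) • (K₁ + K₂ - K₃ - K₄) + (W - 1 - (I * ξ) • (K₁ + K₂ - K₃ - K₄))‖ := by
        rw [add_sub_cancel]
    _ ≤ _ := norm_add_le _ _

omit [CompleteSpace 𝔸] in
/-- **The triangle inequalities behind (3.46) and its τ-version**: ‖b‖ ≤ ‖a‖ + ‖a − b‖ and, for 0 ≤ τ,
‖a′‖ ≤ τ‖b‖ + ‖a′ − τb‖ — the hypotheses `htri₂`, `htri₃` of `B12ExpSteps.condIII_first_of_inputs`, DISCHARGED (a = ∂^ξ𝐇_j(□₀, Q(…)),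
b = ∂^ξH_{1,j}Q(…) the derivative of the linear part, a′ = ∂^ξ𝐇_j(□₀, τQ(…)); the comparison point τb is the print's
*"This inequality is linear in Q(…), hence it is valid also for this expression replaced by τQ(…)"*). [folklore] -/
theorem tri346 (a a' b : 𝔸) {τ : ℝ} (hτ : 0 ≤ τ) :
    ‖b‖ ≤ ‖a‖ + ‖a - b‖ ∧ ‖a'‖ ≤ τ * ‖b‖ + ‖a' - (τ : ℂ) • b‖ := by
  have hτb : ‖(τ : ℂ) • b‖ = τ * ‖b‖ := by rw [norm_smul, Complex.norm_of_nonneg hτ]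
  refine ⟨?_, ?_⟩
  · calc ‖b‖ = ‖a - (a - b)‖ := by rw [sub_sub_cancel]
      _ ≤ _ := norm_sub_le _ _
  · rw [← hτb]
    calc ‖a'‖ = ‖(τ : ℂ) • b - ((τ : ℂ) • b - a')‖ := by rw [sub_sub_cancel]
      _ ≤ ‖(τ : ℂ) • b‖ + ‖(τ : ℂ) • b - a'‖ := norm_sub_le _ _
      _ = ‖(τ : ℂ) • b‖ + ‖a' - (τ : ℂ) • b‖ := by rw [norm_sub_rev]

/-- **(3.44) for the plaquette** (p. 279 [31]: *"|∂^ξ𝐇_j(□₀, Q(L⁻¹η𝐇_{k+1}))| < (1+4β)α₀(L^{j−1}η)² on □̃³. (3.44)"*), with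
∂^ξ𝐇_j(p) = ξ⁻¹(H₁ + H₂ − H₃ − H₄): from the LITERAL first inequality of (3.41) for the plaquette variable W = ∂ exp iξ𝐇_j
(hypothesis `h41`, with its printed (L⁻¹η)²), the four (3.37) bond bounds, `Lemma4Restrictions c` and the three unlisted
constant hypotheses of `B12ExpSteps` (B₃ ≥ 1, B₃²O₁M ≥ 1, 16·O₁Mα₁ ≤ β) — the elementary inequality and the triangle
inequality are now theorems (`helem343`, `tri344`), the constant arithmetic is `B12ExpSteps.ineq344_of_inputs`.
[cite: Balaban1987RG1, (3.44) p.279] -/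
theorem ineq344_plaquette (c : B12Sec2to5.Lemma4Consts) (hR : B12Sec2to5.Lemma4Restrictions c)
    (hB : 1 ≤ c.B₃) (hY : 1 ≤ c.B₃ ^ 2 * c.O₁ * c.M) (hα₁ : 16 * (c.O₁ * c.M * c.α₁) ≤ c.β)
    {η ξ : ℝ} {j : ℕ} (hη : 0 ≤ η) (hj : 1 ≤ j) (hscale : c.L ^ j * η ≤ 1)
    (hξ : 0 < ξ) (hξx : ξ * (c.L ^ (j - 1) * η) = c.L⁻¹ * η) {H₁ H₂ H₃ H₄ : 𝔸}
    (h41 : ‖holonomy [(I * ξ) • H₁, (I * ξ) • H₂, -((I * ξ) • H₃), -((I * ξ) • H₄)] - 1‖ <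
      Real.exp (c.B₃ ^ 2 * c.O₁ * c.M * c.α₀) * Real.exp (c.B₃ * c.O₁ * c.M * c.α₀) *
      Real.exp (c.B₃ * c.O₁ * c.M * c.α₀) * Real.exp (c.O₁ * c.M * c.α₁) *
      ((1 + 2 * c.β) * c.α₀ * (c.L⁻¹ * η) ^ 2))
    (h₁ : ‖H₁‖ < c.B₃ ^ 2 * c.O₁ * c.M * c.α₀ * (c.L ^ (j - 1) * η))
    (h₂ : ‖H₂‖ < c.B₃ ^ 2 * c.O₁ * c.M * c.α₀ * (c.L ^ (j - 1) * η))
    (h₃ : ‖H₃‖ < c.B₃ ^ 2 * c.O₁ * c.M * c.α₀ * (c.L ^ (j - 1) * η))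
    (h₄ : ‖H₄‖ < c.B₃ ^ 2 * c.O₁ * c.M * c.α₀ * (c.L ^ (j - 1) * η)) :
    ‖(ξ : ℂ)⁻¹ • (H₁ + H₂ - H₃ - H₄)‖ < (1 + 4 * c.β) * c.α₀ * (c.L ^ (j - 1) * η) ^ 2 := by
  have hξ2 : 0 < ξ ^ 2 := by positivity
  have hS := sum337 h₁ h₂ h₃ h₄
  have h41a : ‖holonomy [(I * ξ) • H₁, (I * ξ) • H₂, -((I * ξ) • H₃), -((I * ξ) • H₄)] - 1‖ / ξ ^ 2 <
      Real.exp (c.B₃ ^ 2 * c.O₁ * c.M * c.α₀) * Real.exp (c.B₃ * c.O₁ * c.M * c.α₀) *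
      Real.exp (c.B₃ * c.O₁ * c.M * c.α₀) * Real.exp (c.O₁ * c.M * c.α₁) *
      ((1 + 2 * c.β) * c.α₀ * (c.L ^ (j - 1) * η) ^ 2) := by
    rw [div_lt_iff₀ hξ2]
    calc _ < _ := h41
      _ = _ := by rw [← hξx]; ring
  exact B12ExpSteps.ineq344_of_inputs c hR hB hY hα₁ hη hj hscale hξ.le hξx h41a (helem343 hξ H₁ H₂ H₃ H₄) hS.1 hS.2
    (tri344 hξ _ H₁ H₂ H₃ H₄)

/-! ## §4  The first inequality of condition (iii) for the composite configuration, B′ = 0 -/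

/-- **Condition (iii), first inequality (p. 262 [14] (1.14): *"|∂𝐔 − 1| < α₀ξ²"*), for the plaquette variables of the
composite configuration exp iξ𝐇_j(□₀, τQ(L⁻¹η𝐇_{k+1})), B′ = 0, every τ ∈ [0, 1]** — p. 279 *"The above inequality is the
required first inequality in the condition (iii)"* — with EVERY implicit step a theorem: the elementary inequality of
(3.43) at Q(…) and at τQ(…) (`helem343`), the (3.37) sums (`sum337`), the triangle inequalities of (3.44)/(3.46)/(3.47)
(`tri344`, `tri346`, `tri347`), the constant arithmetic (`B12ExpSteps.condIII_first_of_inputs`: (3.41) last step, (3.43),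
(3.44), (3.45) ⇒ (3.46), τ-reversal, (3.47), *"(1+7β)L⁻² ≤ 1"*).  REMAINING INPUTS, all hypotheses about the paper's
objects: the literal first inequality of (3.41) for W = ∂ exp iξ𝐇_j(Q(…)) (`h41`); the (3.37) bond bounds at Q(…) (`hH_i`)
and at τQ(…) (`hK_i`; (3.37) is uniform in τ); the (3.45) second-order bound at Q(…) (`h45`, b = (∂^ξH_{1,j}Q(L⁻¹η𝐇_{k+1}))(p),
the derivative of the LINEAR part of 𝐇_j(□₀, ·) = H_{1,j}· + (≥ 2nd order), (174) [15] = [Balaban1985Variational]) and at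
τQ(…) against τ·b (`h45τ` = the (3.45)-type second-order bound AT τQ(…) that p. 279 *"we can reverse the arguments"*
uses implicitly — the linear part of 𝐇_j(□₀, ·) at τQ is τH_{1,j}Q; the preceding printed sentence *"This inequality is
linear in Q(…)"* refers to (3.46), the bound on that linear part; v1.1 attribution gloss, XREAD R-pv27-71);
`Lemma4Restrictions c` and the three unlisted constant hypotheses of `B12ExpSteps`.  Bond data: H_i = 𝐇_j(Q(…)) and K_i = 𝐇_j(τQ(…)) on the four
positively oriented bonds of ∂p. [cite: Balaban1987RG1, (1.14)(iii) p.262 with (3.41)–(3.47) pp.278–279 — first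
inequality of (iii), B′ = 0] -/
theorem condIII_first_plaquette (c : B12Sec2to5.Lemma4Consts) (hR : B12Sec2to5.Lemma4Restrictions c)
    (hB : 1 ≤ c.B₃) (hY : 1 ≤ c.B₃ ^ 2 * c.O₁ * c.M) (hα₁ : 16 * (c.O₁ * c.M * c.α₁) ≤ c.β)
    {η ξ τ : ℝ} {j : ℕ} (hη : 0 ≤ η) (hj : 1 ≤ j) (hscale : c.L ^ j * η ≤ 1)
    (hξ : 0 < ξ) (hξx : ξ * (c.L ^ (j - 1) * η) = c.L⁻¹ * η) (hτ0 : 0 ≤ τ) (hτ1 : τ ≤ 1)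
    {H₁ H₂ H₃ H₄ K₁ K₂ K₃ K₄ b : 𝔸}
    (h41 : ‖holonomy [(I * ξ) • H₁, (I * ξ) • H₂, -((I * ξ) • H₃), -((I * ξ) • H₄)] - 1‖ <
      Real.exp (c.B₃ ^ 2 * c.O₁ * c.M * c.α₀) * Real.exp (c.B₃ * c.O₁ * c.M * c.α₀) *
      Real.exp (c.B₃ * c.O₁ * c.M * c.α₀) * Real.exp (c.O₁ * c.M * c.α₁) *
      ((1 + 2 * c.β) * c.α₀ * (c.L⁻¹ * η) ^ 2))
    (hH₁ : ‖H₁‖ < c.B₃ ^ 2 * c.O₁ * c.M * c.α₀ * (c.L ^ (j - 1) * η))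
    (hH₂ : ‖H₂‖ < c.B₃ ^ 2 * c.O₁ * c.M * c.α₀ * (c.L ^ (j - 1) * η))
    (hH₃ : ‖H₃‖ < c.B₃ ^ 2 * c.O₁ * c.M * c.α₀ * (c.L ^ (j - 1) * η))
    (hH₄ : ‖H₄‖ < c.B₃ ^ 2 * c.O₁ * c.M * c.α₀ * (c.L ^ (j - 1) * η))
    (h45 : ‖(ξ : ℂ)⁻¹ • (H₁ + H₂ - H₃ - H₄) - b‖ <
      c.B₃ * (c.B₃ * c.O₁ * c.M * c.α₀ * (c.L ^ (j - 1) * η)) ^ 2)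
    (hK₁ : ‖K₁‖ < c.B₃ ^ 2 * c.O₁ * c.M * c.α₀ * (c.L ^ (j - 1) * η))
    (hK₂ : ‖K₂‖ < c.B₃ ^ 2 * c.O₁ * c.M * c.α₀ * (c.L ^ (j - 1) * η))
    (hK₃ : ‖K₃‖ < c.B₃ ^ 2 * c.O₁ * c.M * c.α₀ * (c.L ^ (j - 1) * η))
    (hK₄ : ‖K₄‖ < c.B₃ ^ 2 * c.O₁ * c.M * c.α₀ * (c.L ^ (j - 1) * η))
    (h45τ : ‖(ξ : ℂ)⁻¹ • (K₁ + K₂ - K₃ - K₄) - (τ : ℂ) • b‖ <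
      c.B₃ * (c.B₃ * c.O₁ * c.M * c.α₀ * (c.L ^ (j - 1) * η)) ^ 2) :
    ‖holonomy [(I * ξ) • K₁, (I * ξ) • K₂, -((I * ξ) • K₃), -((I * ξ) • K₄)] - 1‖ < c.α₀ * ξ ^ 2 := by
  have hξ2 : 0 < ξ ^ 2 := by positivity
  have hS := sum337 hH₁ hH₂ hH₃ hH₄
  have hSτ := sum337 hK₁ hK₂ hK₃ hK₄
  have h41a : ‖holonomy [(I * ξ) • H₁, (I * ξ) • H₂, -((I * ξ) • H₃), -((I * ξ) • H₄)] - 1‖ / ξ ^ 2 <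
      Real.exp (c.B₃ ^ 2 * c.O₁ * c.M * c.α₀) * Real.exp (c.B₃ * c.O₁ * c.M * c.α₀) *
      Real.exp (c.B₃ * c.O₁ * c.M * c.α₀) * Real.exp (c.O₁ * c.M * c.α₁) *
      ((1 + 2 * c.β) * c.α₀ * (c.L ^ (j - 1) * η) ^ 2) := by
    rw [div_lt_iff₀ hξ2]
    calc _ < _ := h41
      _ = _ := by rw [← hξx]; ring
  have htri := tri346 ((ξ : ℂ)⁻¹ • (H₁ + H₂ - H₃ - H₄)) ((ξ : ℂ)⁻¹ • (K₁ + K₂ - K₃ - K₄)) b hτ0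
  have hE := B12ExpSteps.condIII_first_of_inputs c hR hB hY hα₁ hη hj hscale hξ.le hξx h41a
    (helem343 hξ H₁ H₂ H₃ H₄) hS.1 hS.2 (tri344 hξ _ H₁ H₂ H₃ H₄) h45 htri.1 hτ0 hτ1 (norm_nonneg b) h45τ htri.2
    (helem343 hξ K₁ K₂ K₃ K₄) hSτ.1 hSτ.2
    (tri347 hξ (holonomy [(I * ξ) • K₁, (I * ξ) • K₂, -((I * ξ) • K₃), -((I * ξ) • K₄)]) K₁ K₂ K₃ K₄)
  rwa [div_lt_iff₀ hξ2] at hE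

/-! ## §5  B′ ≠ 0: (3.50)–(3.52) for the plaquette — *"(3.43) slightly modified for the present situation"* and the
count 1+8β, whose extra β CLOSES from the typed restrictions -/

omit [CompleteSpace 𝔸] in
/-- **(3.51), first «≦», for the plaquette**: with the shifted bond data K_i + A_i of (3.50) (𝐇_j(□₀, τQ(…) + B′) =
𝐇_j(□₀, τQ(…)) + 𝐀₂ bondwise), ‖∂^ξ(𝐊 + 𝐀)‖ ≤ ‖∂^ξ𝐊‖ + ‖∂^ξ𝐀‖ (linearity of ∂^ξ + triangle inequality).
[cite: Balaban1987RG1, (3.51) p.280 — first inequality] -/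
theorem deriv_shift_le (ξ : ℝ) (K₁ K₂ K₃ K₄ A₁ A₂ A₃ A₄ : 𝔸) :
    ‖(ξ : ℂ)⁻¹ • ((K₁ + A₁) + (K₂ + A₂) - (K₃ + A₃) - (K₄ + A₄))‖ ≤
      ‖(ξ : ℂ)⁻¹ • (K₁ + K₂ - K₃ - K₄)‖ + ‖(ξ : ℂ)⁻¹ • (A₁ + A₂ - A₃ - A₄)‖ := by
  have h : (ξ : ℂ)⁻¹ • ((K₁ + A₁) + (K₂ + A₂) - (K₃ + A₃) - (K₄ + A₄)) =
      (ξ : ℂ)⁻¹ • (K₁ + K₂ - K₃ - K₄) + (ξ : ℂ)⁻¹ • (A₁ + A₂ - A₃ - A₄) := by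
    rw [← smul_add]
    congr 1
    abel
  rw [h]
  exact norm_add_le _ _

omit [CompleteSpace 𝔸] in
/-- **|∂^ξ𝐀₂| ≤ 2·|∇^ξ𝐀₂|** (the "2" of (3.51)'s *"+ 2B₃α₃"*): on p = p_{μν}(x), (∂^ξ𝐀)(p) = ξ⁻¹(A₁ + A₂ − A₃ − A₄) =
(∇^ξ_μ𝐀_ν)(x) − (∇^ξ_ν𝐀_μ)(x) with (∇^ξ_μ𝐀_ν)(x) = ξ⁻¹(A₂ − A₄), (∇^ξ_ν𝐀_μ)(x) = ξ⁻¹(A₃ − A₁); so the two gradient bounds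
*"|∇^ξ𝐀₂| ≤ B₃|B′|"* of p. 280 give ‖∂^ξ𝐀₂‖ ≤ 2B₃|B′|. [cite: Balaban1987RG1, p.280 line 2 with (3.51) — the term 2B₃α₃] -/
theorem deriv_A_le (ξ : ℝ) (A₁ A₂ A₃ A₄ : 𝔸) {g : ℝ} (hμ : ‖(ξ : ℂ)⁻¹ • (A₂ - A₄)‖ ≤ g)
    (hν : ‖(ξ : ℂ)⁻¹ • (A₃ - A₁)‖ ≤ g) :
    ‖(ξ : ℂ)⁻¹ • (A₁ + A₂ - A₃ - A₄)‖ ≤ 2 * g := by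
  have h : (ξ : ℂ)⁻¹ • (A₁ + A₂ - A₃ - A₄) = (ξ : ℂ)⁻¹ • (A₂ - A₄) - (ξ : ℂ)⁻¹ • (A₃ - A₁) := by
    rw [← smul_sub]
    congr 1
    abel
  rw [h]
  calc _ ≤ ‖(ξ : ℂ)⁻¹ • (A₂ - A₄)‖ + ‖(ξ : ℂ)⁻¹ • (A₃ - A₁)‖ := norm_sub_le _ _
    _ ≤ g + g := add_le_add hμ hν
    _ = 2 * g := by ring

/-- **"(3.43) slightly modified for the present situation"** (p. 280), PROVED: for the shifted bond data K_i + A_i with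
‖K_i‖ < h ((3.37) at τQ(…)) and ‖A_i‖ ≤ a ((3.50): |𝐀₂| ≤ B₃|B′|), the first-order remainder of the plaquette obeys
‖∂ exp iξ(𝐊 + 𝐀) − 1 − iξ²∂^ξ(𝐊 + 𝐀)‖ ≤ 8(h + a)²ξ² exp 4ξ(h + a) (§1 with s = 4ξ(h + a) ≥ ξ·Σ‖K_i + A_i‖).
[cite: Balaban1987RG1, p.280 before (3.52) — "(3.43) slightly modified", PROVED under the plaquette reading] -/
theorem elem343_shift {ξ h a : ℝ} (hξ : 0 ≤ ξ) {K₁ K₂ K₃ K₄ A₁ A₂ A₃ A₄ : 𝔸}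
    (hK₁ : ‖K₁‖ < h) (hK₂ : ‖K₂‖ < h) (hK₃ : ‖K₃‖ < h) (hK₄ : ‖K₄‖ < h)
    (hA₁ : ‖A₁‖ ≤ a) (hA₂ : ‖A₂‖ ≤ a) (hA₃ : ‖A₃‖ ≤ a) (hA₄ : ‖A₄‖ ≤ a) :
    ‖holonomy [(I * ξ) • (K₁ + A₁), (I * ξ) • (K₂ + A₂), -((I * ξ) • (K₃ + A₃)), -((I * ξ) • (K₄ + A₄))] - 1
        - (I * ξ) • ((K₁ + A₁) + (K₂ + A₂) - (K₃ + A₃) - (K₄ + A₄))‖ ≤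
      8 * (h + a) ^ 2 * ξ ^ 2 * Real.exp (4 * ξ * (h + a)) := by
  have hs : size [(I * ξ) • (K₁ + A₁), (I * ξ) • (K₂ + A₂), -((I * ξ) • (K₃ + A₃)), -((I * ξ) • (K₄ + A₄))]
      ≤ ξ * (4 * (h + a)) := by
    rw [size_plaquette hξ]
    apply mul_le_mul_of_nonneg_left _ hξ
    have h₁ := norm_add_le K₁ A₁
    have h₂ := norm_add_le K₂ A₂
    have h₃ := norm_add_le K₃ A₃
    have h₄ := norm_add_le K₄ A₄
    linarith
  have h := norm_holonomy_sub_one_sub_sum_le _ hs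
  rw [sum_plaquette] at h
  calc _ ≤ _ := h
    _ = _ := by ring_nf

/-- **The budget of the extra β in (3.52) CLOSES from the typed restrictions** (no new smallness): with h = B₃²O(1)Mα₀x
(x = L^{j−1}η ≤ L⁻¹), a = B₃α₃, the modified (3.43)-remainder coefficient satisfies 8(h + a)² exp 4ξ(h + a) < βL⁻²α₀ — the
single β by which (3.51)'s 1+7β becomes (3.52)'s 1+8β — under conj. 10 *"(4B₃²O(1)M)²α₀ ≤ β"*, conj. 13 *"2B₃α₃ ≤ βL⁻²α₀"*,
conj. 14 *"1+8β ≤ L²"*, β ≤ 1, B₃²O(1)M ≥ 1 (unlisted, as in `B12ExpSteps`), B₃α₃ ≥ 0 and 0 ≤ ξ ≤ 1 (ξ = L^{−j}).  Chain: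
u := 4B₃²O(1)Mα₀L⁻¹ has u² ≤ βL⁻²α₀ =: B ≤ α₀/8 ≤ β/128 ≤ 1/128 (16α₀ ≤ (4B₃²O(1)M)²α₀ ≤ β, βL⁻² ≤ 1/8), so u ≤ 1/11;
h ≤ u/4, a ≤ B/2; 8(h+a)² ≤ ½(u+2B)² ≤ ½(1 + 4/11 + 1/32)B; exp 4ξ(h+a) ≤ 1 + 2(u+2B) ≤ 1 + 2/11 + 1/32
(`Real.abs_exp_sub_one_le`); product ≤ 0.85·B < B. [folklore] -/
theorem budget352 {B₃ O₁ M α₀ α₃ β L ξ x : ℝ} (hα₀ : 0 < α₀) (hβ : 0 < β) (hβ1 : β ≤ 1)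
    (hY : 1 ≤ B₃ ^ 2 * O₁ * M) (hres10 : (4 * B₃ ^ 2 * O₁ * M) ^ 2 * α₀ ≤ β)
    (ha0 : 0 ≤ B₃ * α₃) (hres13 : 2 * B₃ * α₃ ≤ β * L⁻¹ ^ 2 * α₀) (hL : 0 < L) (hres8 : 1 + 8 * β ≤ L ^ 2)
    (hξ0 : 0 ≤ ξ) (hξ1 : ξ ≤ 1) (hx0 : 0 ≤ x) (hx : x ≤ L⁻¹) :
    8 * (B₃ ^ 2 * O₁ * M * α₀ * x + B₃ * α₃) ^ 2 *
        Real.exp (4 * ξ * (B₃ ^ 2 * O₁ * M * α₀ * x + B₃ * α₃)) < β * L⁻¹ ^ 2 * α₀ := by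
  set K := 4 * B₃ ^ 2 * O₁ * M with hK
  set h := B₃ ^ 2 * O₁ * M * α₀ * x with hh
  set a := B₃ * α₃ with ha
  set Bq := β * L⁻¹ ^ 2 * α₀ with hBq
  have hLi : 0 < L⁻¹ := inv_pos.mpr hL
  have hK4 : 4 ≤ K := by rw [hK]; linarith
  have hK0 : 0 ≤ K := by linarith
  have hK2 : 16 ≤ K ^ 2 := by nlinarith [mul_nonneg (sub_nonneg.2 hK4) (by linarith : (0:ℝ) ≤ K + 4)]
  have hK16 : 16 * α₀ ≤ K ^ 2 * α₀ := mul_le_mul_of_nonneg_right hK2 hα₀.le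
  have hα₀16 : 16 * α₀ ≤ β := le_trans hK16 hres10
  have hβL : β * L⁻¹ ^ 2 ≤ 1 / 8 := by
    rw [inv_pow, ← div_eq_mul_inv, div_le_iff₀ (by positivity)]
    linarith
  have hBq0 : 0 < Bq := by positivity
  have hBq1 : Bq ≤ 1 / 128 := by
    calc Bq = β * L⁻¹ ^ 2 * α₀ := rfl
      _ ≤ 1 / 8 * α₀ := mul_le_mul_of_nonneg_right hβL hα₀.le
      _ ≤ 1 / 128 := by linarith
  set u := K * α₀ * L⁻¹ with hu
  have hu0 : 0 ≤ u := mul_nonneg (mul_nonneg hK0 hα₀.le) hLi.le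
  have hu2 : u ^ 2 ≤ Bq := by
    have h1 : u ^ 2 = K ^ 2 * α₀ * (α₀ * L⁻¹ ^ 2) := by rw [hu]; ring
    have h2 : Bq = β * (α₀ * L⁻¹ ^ 2) := by rw [hBq]; ring
    rw [h1, h2]
    exact mul_le_mul_of_nonneg_right hres10 (by positivity)
  have hu11 : u ≤ 1 / 11 := by nlinarith
  have hKα : 0 ≤ K / 4 * α₀ := by positivity
  have hhu : h ≤ u / 4 := by
    have e1 : h = K / 4 * α₀ * x := by rw [hh, hK]; ring
    rw [e1]
    calc K / 4 * α₀ * x ≤ K / 4 * α₀ * L⁻¹ := mul_le_mul_of_nonneg_left hx hKα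
      _ = u / 4 := by rw [hu]; ring
  have hh0 : 0 ≤ h := by
    have : 0 ≤ B₃ ^ 2 * O₁ * M := by linarith
    rw [hh]
    positivity
  have haB : a ≤ Bq / 2 := by rw [ha, hBq]; linarith
  have hha0 : 0 ≤ h + a := add_nonneg hh0 ha0
  have hw : 4 * ξ * (h + a) ≤ u + 2 * Bq := by
    have h1 : ξ * (h + a) ≤ 1 * (h + a) := mul_le_mul_of_nonneg_right hξ1 hha0
    linarith
  have hw0 : 0 ≤ 4 * ξ * (h + a) := by positivity
  have hE : Real.exp (4 * ξ * (h + a)) ≤ 1 + 2 * (u + 2 * Bq) := by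
    have habs : |4 * ξ * (h + a)| ≤ 1 := by rw [abs_of_nonneg hw0]; linarith
    have h1 := Real.abs_exp_sub_one_le habs
    rw [abs_of_nonneg hw0] at h1
    have h2 : Real.exp (4 * ξ * (h + a)) - 1 ≤ 2 * (4 * ξ * (h + a)) := le_trans (le_abs_self _) h1
    linarith
  have hpoly : 8 * (h + a) ^ 2 ≤ 1 / 2 * (u + 2 * Bq) ^ 2 := by
    have h1 : h + a ≤ (u + 2 * Bq) / 4 := by linarith
    have h3 : (h + a) ^ 2 ≤ ((u + 2 * Bq) / 4) ^ 2 := pow_le_pow_left₀ hha0 h1 2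
    calc 8 * (h + a) ^ 2 ≤ 8 * ((u + 2 * Bq) / 4) ^ 2 := by linarith
      _ = 1 / 2 * (u + 2 * Bq) ^ 2 := by ring
  have hsq : (u + 2 * Bq) ^ 2 ≤ (1 + 4 / 11 + 1 / 32) * Bq := by
    have h1 : u * Bq ≤ 1 / 11 * Bq := mul_le_mul_of_nonneg_right hu11 hBq0.le
    have h2 : Bq * Bq ≤ 1 / 128 * Bq := mul_le_mul_of_nonneg_right hBq1 hBq0.le
    nlinarith [hu2]
  have hE0 : 0 ≤ Real.exp (4 * ξ * (h + a)) := (Real.exp_pos _).le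
  calc 8 * (h + a) ^ 2 * Real.exp (4 * ξ * (h + a))
      ≤ 1 / 2 * (u + 2 * Bq) ^ 2 * (1 + 2 * (u + 2 * Bq)) := mul_le_mul hpoly hE hE0 (by positivity)
    _ ≤ 1 / 2 * ((1 + 4 / 11 + 1 / 32) * Bq) * (1 + 2 * (1 / 11 + 1 / 64)) := by
        apply mul_le_mul _ (by linarith) (by positivity) (by positivity)
        linarith [hsq]
    _ < Bq := by linarith

/-- The same budget from `Lemma4Restrictions c` (conj. 1, 4, 5, 6, 7, 8, 10, 13, 14) + B₃ ≥ 1 + B₃²O₁M ≥ 1, at any scale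
1 ≤ j with L^jη ≤ 1 (so x = L^{j−1}η ≤ L⁻¹, `B12CondIIIJ.scale_le`) and 0 ≤ ξ ≤ 1. [folklore] -/
theorem budget352_of_restrictions (c : B12Sec2to5.Lemma4Consts) (hR : B12Sec2to5.Lemma4Restrictions c)
    (hB : 1 ≤ c.B₃) (hY : 1 ≤ c.B₃ ^ 2 * c.O₁ * c.M) {η ξ : ℝ} {j : ℕ} (hη : 0 ≤ η) (hj : 1 ≤ j)
    (hscale : c.L ^ j * η ≤ 1) (hξ0 : 0 ≤ ξ) (hξ1 : ξ ≤ 1) :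
    8 * (c.B₃ ^ 2 * c.O₁ * c.M * c.α₀ * (c.L ^ (j - 1) * η) + c.B₃ * c.α₃) ^ 2 *
        Real.exp (4 * ξ * (c.B₃ ^ 2 * c.O₁ * c.M * c.α₀ * (c.L ^ (j - 1) * η) + c.B₃ * c.α₃)) <
      c.β * c.L⁻¹ ^ 2 * c.α₀ := by
  have hR' := hR
  unfold B12Sec2to5.Lemma4Restrictions at hR'
  obtain ⟨hα₀, _, _, hα₃, hβ, hββ₀, hβ₀, hL1, _, hres10, _, _, hres13, hres8⟩ := hR'
  have hLpos : 0 < c.L := by linarith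
  exact budget352 hα₀ hβ (by linarith) hY hres10 (mul_nonneg (by linarith) hα₃.le) hres13 hLpos hres8 hξ0 hξ1
    (B12CondIIIJ.scale_nonneg j hLpos hη) (B12CondIIIJ.scale_le hLpos hη hj hscale)

/-- **Condition (iii), first inequality, B′ ≠ 0 — the displays (3.50)–(3.52) for the plaquette with the PRINTED count
1+8β** (p. 280 [32]: *"|∂^ξ𝐇_j(□₀, τQ(L⁻¹η𝐇_{k+1}) + B′)| ≤ |∂^ξ𝐇_j(□₀, τQ(L⁻¹η𝐇_{k+1}))| + |∂^ξ𝐀₂| < (1+6β)α₀(L^{j−1}η)² +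
2B₃α₃ ≤ (1+6β)L⁻²α₀ + 2B₃α₃ ≤ (1+7β)L⁻²α₀ on □̃³, (3.51) where we have assumed 2B₃α₃ ≤ βL⁻²α₀. The above inequality,
and the inequality (3.43) slightly modified for the present situation, give the bound |∂ exp iξ𝐇_j(□₀, τQ(L⁻¹η𝐇_{k+1}) + B′)
− 1| < (1+8β)L⁻²α₀ξ² on □̃³. (3.52) This implies the first inequality in the condition (iii)."*).  Bond data of the shifted
configuration: K_i + A_i ((3.50): 𝐇_j(□₀, τQ(…) + B′) = 𝐇_j(□₀, τQ(…)) + 𝐀₂).  INPUTS, all hypotheses about the paper's objects: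
those of `condIII_first_plaquette` (which give *"(3.44) with τQ(…), and the factor 1+6β"* for ∂^ξ𝐊 through
`ineq344_plaquette`, `B12CondIIIJ.ineq345_inner/ineq346/ineq344τ`); (3.50) *"|𝐀₂|, |∇^ξ𝐀₂| ≤ B₃|B′| < B₃α₃"* as the four
bond bounds `hA_i` and the two gradient bounds `hdμ`, `hdν` at p, with n = |B′| < α₃ (`hn`); 0 < ξ ≤ 1 (`hξ1`: for η > 0 the
scale relation `hξx` ξ·L^{j−1}η = L⁻¹η already forces ξ = L^{−j} ≤ 1, so `hξ1` is an independent hypothesis only in the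
degenerate case η = 0 — kept explicit, harmless; v1.1 remark, XREAD C-adv2-67 R2).  KERNEL: (3.51)
(`deriv_shift_le`, `deriv_A_le`, `B12Sec2to5.ineq351`), the modified (3.43) (`elem343_shift`), its β-budget (`budget352`,
no new smallness), the triangle inequality and *"This implies the first inequality in the condition (iii)"*
(`B12Sec2to5.ineq352_closes`: (1+8β)L⁻² ≤ 1 ⇐ conj. 14).  Conclusion: the literal (iii) p. 262 (1.14) |∂𝐔 − 1| < α₀ξ² for
the plaquette variable of exp iξ(𝐇_j(□₀, τQ(…)) + 𝐀₂). [cite: Balaban1987RG1, (3.50)–(3.52) p.280 with (1.14)(iii) p.262 —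
first inequality of (iii), B′ ≠ 0] -/
theorem condIII_first_plaquette_shifted (c : B12Sec2to5.Lemma4Consts) (hR : B12Sec2to5.Lemma4Restrictions c)
    (hB : 1 ≤ c.B₃) (hY : 1 ≤ c.B₃ ^ 2 * c.O₁ * c.M) (hα₁ : 16 * (c.O₁ * c.M * c.α₁) ≤ c.β)
    {η ξ τ n : ℝ} {j : ℕ} (hη : 0 ≤ η) (hj : 1 ≤ j) (hscale : c.L ^ j * η ≤ 1)
    (hξ : 0 < ξ) (hξ1 : ξ ≤ 1) (hξx : ξ * (c.L ^ (j - 1) * η) = c.L⁻¹ * η) (hτ0 : 0 ≤ τ) (hτ1 : τ ≤ 1)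
    {H₁ H₂ H₃ H₄ K₁ K₂ K₃ K₄ b A₁ A₂ A₃ A₄ : 𝔸}
    (h41 : ‖holonomy [(I * ξ) • H₁, (I * ξ) • H₂, -((I * ξ) • H₃), -((I * ξ) • H₄)] - 1‖ <
      Real.exp (c.B₃ ^ 2 * c.O₁ * c.M * c.α₀) * Real.exp (c.B₃ * c.O₁ * c.M * c.α₀) *
      Real.exp (c.B₃ * c.O₁ * c.M * c.α₀) * Real.exp (c.O₁ * c.M * c.α₁) *
      ((1 + 2 * c.β) * c.α₀ * (c.L⁻¹ * η) ^ 2))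
    (hH₁ : ‖H₁‖ < c.B₃ ^ 2 * c.O₁ * c.M * c.α₀ * (c.L ^ (j - 1) * η))
    (hH₂ : ‖H₂‖ < c.B₃ ^ 2 * c.O₁ * c.M * c.α₀ * (c.L ^ (j - 1) * η))
    (hH₃ : ‖H₃‖ < c.B₃ ^ 2 * c.O₁ * c.M * c.α₀ * (c.L ^ (j - 1) * η))
    (hH₄ : ‖H₄‖ < c.B₃ ^ 2 * c.O₁ * c.M * c.α₀ * (c.L ^ (j - 1) * η))
    (h45 : ‖(ξ : ℂ)⁻¹ • (H₁ + H₂ - H₃ - H₄) - b‖ <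
      c.B₃ * (c.B₃ * c.O₁ * c.M * c.α₀ * (c.L ^ (j - 1) * η)) ^ 2)
    (hK₁ : ‖K₁‖ < c.B₃ ^ 2 * c.O₁ * c.M * c.α₀ * (c.L ^ (j - 1) * η))
    (hK₂ : ‖K₂‖ < c.B₃ ^ 2 * c.O₁ * c.M * c.α₀ * (c.L ^ (j - 1) * η))
    (hK₃ : ‖K₃‖ < c.B₃ ^ 2 * c.O₁ * c.M * c.α₀ * (c.L ^ (j - 1) * η))
    (hK₄ : ‖K₄‖ < c.B₃ ^ 2 * c.O₁ * c.M * c.α₀ * (c.L ^ (j - 1) * η))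
    (h45τ : ‖(ξ : ℂ)⁻¹ • (K₁ + K₂ - K₃ - K₄) - (τ : ℂ) • b‖ <
      c.B₃ * (c.B₃ * c.O₁ * c.M * c.α₀ * (c.L ^ (j - 1) * η)) ^ 2)
    (hn : n < c.α₃) (hA₁ : ‖A₁‖ ≤ c.B₃ * n) (hA₂ : ‖A₂‖ ≤ c.B₃ * n) (hA₃ : ‖A₃‖ ≤ c.B₃ * n)
    (hA₄ : ‖A₄‖ ≤ c.B₃ * n) (hdμ : ‖(ξ : ℂ)⁻¹ • (A₂ - A₄)‖ ≤ c.B₃ * n) (hdν : ‖(ξ : ℂ)⁻¹ • (A₃ - A₁)‖ ≤ c.B₃ * n) :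
    ‖holonomy [(I * ξ) • (K₁ + A₁), (I * ξ) • (K₂ + A₂), -((I * ξ) • (K₃ + A₃)), -((I * ξ) • (K₄ + A₄))] - 1‖ <
      c.α₀ * ξ ^ 2 := by
  have hR' := hR
  unfold B12Sec2to5.Lemma4Restrictions at hR'
  obtain ⟨hα₀, _, _, hα₃, hβ, _, _, hL1, _, hres10, _, _, hres13, hres8⟩ := hR'
  have hLpos : 0 < c.L := by linarith
  have hξ2 : 0 < ξ ^ 2 := by positivity
  have hB0 : 0 ≤ c.B₃ := by linarith
  -- the B′ = 0 ladder up to "(3.44) with τQ(…), and the factor 1+6β"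
  have h44 := ineq344_plaquette c hR hB hY hα₁ hη hj hscale hξ hξx h41 hH₁ hH₂ hH₃ hH₄
  have h45i := B12CondIIIJ.ineq345_inner (x := c.L ^ (j - 1) * η) hα₀.le hB hres10
  have htri := tri346 ((ξ : ℂ)⁻¹ • (H₁ + H₂ - H₃ - H₄)) ((ξ : ℂ)⁻¹ • (K₁ + K₂ - K₃ - K₄)) b hτ0
  have h46 := B12CondIIIJ.ineq346 htri.1 h44 (lt_of_lt_of_le h45 h45i)
  have h44τ := B12CondIIIJ.ineq344τ hτ0 hτ1 (norm_nonneg b) h46 (lt_of_lt_of_le h45τ h45i) htri.2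
  -- (3.51)
  have hnα : c.B₃ * n ≤ c.B₃ * c.α₃ := mul_le_mul_of_nonneg_left hn.le hB0
  have hdA : ‖(ξ : ℂ)⁻¹ • (A₁ + A₂ - A₃ - A₄)‖ ≤ 2 * (c.B₃ * n) := deriv_A_le ξ A₁ A₂ A₃ A₄ hdμ hdν
  have h351 := B12Sec2to5.ineq351 hLpos hη hj hscale hβ.le hα₀.le hres13
  have h51 : ‖(ξ : ℂ)⁻¹ • ((K₁ + A₁) + (K₂ + A₂) - (K₃ + A₃) - (K₄ + A₄))‖ < (1 + 7 * c.β) * c.L⁻¹ ^ 2 * c.α₀ := by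
    have h1 := deriv_shift_le ξ K₁ K₂ K₃ K₄ A₁ A₂ A₃ A₄
    linarith [h351.1, h351.2]
  -- "(3.43) slightly modified" and its budget
  have hrem := elem343_shift hξ.le hK₁ hK₂ hK₃ hK₄ (hA₁.trans hnα) (hA₂.trans hnα) (hA₃.trans hnα) (hA₄.trans hnα)
  have hbud := budget352_of_restrictions c hR hB hY hη hj hscale hξ.le hξ1
  -- (3.52)
  have h52 := B12Sec2to5.ineq352_closes hLpos hα₀.le hres8
  have hlin0 := norm_deriv_eq hξ ((K₁ + A₁) + (K₂ + A₂) - (K₃ + A₃) - (K₄ + A₄))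
  set W' := holonomy [(I * ξ) • (K₁ + A₁), (I * ξ) • (K₂ + A₂), -((I * ξ) • (K₃ + A₃)),
    -((I * ξ) • (K₄ + A₄))] with hW'
  set S' := (K₁ + A₁) + (K₂ + A₂) - (K₃ + A₃) - (K₄ + A₄) with hS'
  have hlin : ‖(I * ξ) • S'‖ = ‖(ξ : ℂ)⁻¹ • S'‖ * ξ ^ 2 := by
    rw [hlin0, div_mul_cancel₀ _ hξ2.ne']
  have htri' : ‖W' - 1‖ ≤ ‖(I * ξ) • S'‖ + ‖W' - 1 - (I * ξ) • S'‖ := by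
    calc ‖W' - 1‖ = ‖(I * ξ) • S' + (W' - 1 - (I * ξ) • S')‖ := by rw [add_sub_cancel]
      _ ≤ _ := norm_add_le _ _
  have step1 : ‖(I * ξ) • S'‖ < (1 + 7 * c.β) * c.L⁻¹ ^ 2 * c.α₀ * ξ ^ 2 := by
    rw [hlin]
    exact mul_lt_mul_of_pos_right h51 hξ2
  have step2 : ‖W' - 1 - (I * ξ) • S'‖ < c.β * c.L⁻¹ ^ 2 * c.α₀ * ξ ^ 2 := by
    calc _ ≤ _ := hrem
      _ = 8 * (c.B₃ ^ 2 * c.O₁ * c.M * c.α₀ * (c.L ^ (j - 1) * η) + c.B₃ * c.α₃) ^ 2 *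
            Real.exp (4 * ξ * (c.B₃ ^ 2 * c.O₁ * c.M * c.α₀ * (c.L ^ (j - 1) * η) + c.B₃ * c.α₃)) * ξ ^ 2 := by
          ring
      _ < _ := mul_lt_mul_of_pos_right hbud hξ2
  calc ‖W' - 1‖ ≤ ‖(I * ξ) • S'‖ + ‖W' - 1 - (I * ξ) • S'‖ := htri'
    _ < (1 + 7 * c.β) * c.L⁻¹ ^ 2 * c.α₀ * ξ ^ 2 + c.β * c.L⁻¹ ^ 2 * c.α₀ * ξ ^ 2 := add_lt_add step1 step2
    _ = (1 + 8 * c.β) * c.L⁻¹ ^ 2 * c.α₀ * ξ ^ 2 := by ring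
    _ ≤ c.α₀ * ξ ^ 2 := mul_le_mul_of_nonneg_right h52 hξ2.le

end Literature.MathematicalPhysics.QuantumFieldTheory.Balaban1983to89.B12Plaquette343
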